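import Mathlib.LinearAlgebra.Eigenspace.Triangularizable
import Literature.NumberTheory.Automorphic.ArchTranslateExpStable
import Literature.NumberTheory.Automorphic.AutomorphicRepsGLOneArchParameter
import Literature.NumberTheory.Automorphic.CompletedCohomologyHeckeAlgebraGLn
import Literature.NumberTheory.Automorphic.GLOneOfHeckeCharacterBJ
import Literature.Barriers.Langlands.NonRegularWeightBarrier
import HarnessLib

/-!
# Cuspidal eigenclasses for `GL_1 / ℚ`: the rank-one case of `cuspidalEigenclass_exists`
# (automorphic side: the quasi-character of an automorphic representation of `GL₁`)

Topic `NumberTheory/Automorphic`; proof file (theorems only: no definition, no named fact, no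
instance), companion of `CuspidalCohomologyGLRankOneProofs` (cohomological side) and input of
`CuspidalCohomologyGLRankOneHolds` (assembly), under the named fact
`Literature.NumberTheory.Automorphic.GLnCohomology.cuspidalEigenclass_exists`
(`CuspidalCohomologyGL`; Eichler–Shimura, Borel, Clozel as summarised in
[RaghuramShahidi2010, §2.2]: a cuspidal automorphic representation of `GL_n(𝔸_ℚ)` of
cohomological infinity type with a `K(N)`-fixed vector has a non-zero simultaneous Hecke
eigenclass in `H^{b_n}_!(S(K_f(N)), Ṽ_λ ⊗ ℂ)` with its Satake–Tamagawa eigenvalues).  For general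
`n` the printed proof compares the cohomology of `S(K_f)` with relative Lie algebra cohomology, a
theory absent from the tree; this file and its sequel complete the case **`n = 1`**
(`GLnCohomology.cuspidalEigenclass_exists_rank_one` in `CuspidalCohomologyGLRankOneHolds`), where the
statement is that an algebraic
idèle class character `χ` of `ℚ` of infinity type `t ↦ t^{-λ₀}` and conductor dividing `N` gives
the `ℚ^×_{>0}`-invariant eigenfunction `c ↦ χ_f(c)` on the ray class set
`𝔸_{ℚ,f}^× / K_f(N)` with values in the line `V_λ = det^{λ₀}` (the cohomological side,
`GLnCohomology.exists_cuspidalEigenclass_one_of_character`, is in the prequel).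

What has to be proved is the dictionary "automorphic representation of `GL₁(𝔸_K)` in the sense of
Borel–Jacquet (`AutomorphicRepData`, a pair `W' < W` of `(𝔤, K_∞) × GL₁(𝔸_K^∞)`-stable spaces of
automorphic forms with `W / W'` irreducible) = quasi-character of `𝔸_Kˣ / Kˣ`" (Gelbart 1975,
§2.A), including its archimedean component, in a form valid for data with `W' ≠ ⊥` (the tree's
example `W = ⟨log |·|_𝔸, 1⟩ ⊃ W' = ℂ · 1` of `AutomorphicRepsGLOneLine` shows that `W` need not be
spanned by the character, nor split):

* `AutomorphicRepData.exists_quasiCharacter_glOne` — **the quasi-character** `ω_π : GL₁(𝔸_K) → ℂˣ`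
  of `π = W / W'`: every `g` acts on the line `W / W'` by `ω_π(g)` (Schur modulo `W'` for each
  `g`, `AutomorphicRepData.exists_rightTranslation_sub_smul_mem_glOne'` of `ArchTranslateExpStable`;
  uniqueness and multiplicativity of the scalars); `rightTranslation_toAdelic_eq_glOne`:
  `GL₁(K)` acts trivially (left invariance, commutativity).
* `eq_exp_mul_sum_of_hasDerivAt_chain` — the linear ODE of a Jordan chain:
  `u_j' = μ u_j + u_{j+1}`, `u_k = 0` forces `u_0(t) = e^{μt} ∑_{j<k} t^j/j! · u_j(0)`.
* `AutomorphicRepData.exists_iterate_lieDeriv_sub_smul_eq_zero_glOne` — if `X ∈ 𝔤𝔩₁(K_∞)` acts on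
  `W / W'` by `d`, some `φ₁ ∈ W ∖ W'` is a generalised eigenvector, `(X - d)^k φ₁ = 0`
  (generalised eigenspaces of `X` on the finite-dimensional `Z(𝔤)`-orbit span of a form, Mathlib
  `Module.End.iSup_maxGenEigenspace_eq_top`; those for `ν ≠ d` lie in `W'`).
* `AutomorphicRepData.rightTranslation_expMem_sub_exp_smul_mem_glOne` — **one-parameter subgroups
  act on `W / W'` through `exp`**: `ω_π(exp tX) = e^{t d}` (the flow of `φ₁` is an exponential
  polynomial whose higher terms lie in `W'`).  For `W' = ⊥` this is
  `AutomorphicRepData.exists_apply_posRealScalar_mul_eq_cpow` of `AutomorphicRepDataSplitCenter`.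
* `K = ℚ`: `lieDeriv_one_sub_smul_mem_of_hasInfinityType_rat` — a representation of infinity type
  `cohomologicalInfinityType 1 ℚ λ` has `1 ∈ 𝔤𝔩₁(ℝ)` acting on `W / W'` by `λ₀` (the archimedean
  parameter of a `GL₁` datum, `AutomorphicRepsGLOneArchParameter`, and its uniqueness,
  `ArchParameterUnique`); `toAdelic_eq_posRealScalar_mul_ofFinite_rat` (`γ = γ_∞ · (1, γ_f)` for
  rational `γ > 0`, with `realToInfiniteAdele_ratCast`); hence
  `rightTranslation_ofFinite_rat_sub_smul_mem`: **`(1, γ_f)` acts on `W / W'` by `γ^{-s}`** when `1`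
  acts by `s` — the relation `χ_f(γ) = χ_∞(γ)⁻¹`.
* `AutomorphicRepData.quasiCharacter_heckeElement_eq_of_hasSatakeParamAt` — **`ω_π(t_{v,i})` is the
  Satake–Tamagawa eigenvalue** `q_v^{i(1-i)/2} e_i(α)` of any Satake parameter `α` of `π` at
  `v ∤ 𝔫` when `ω_π` is trivial on `K(𝔫)` (in rank one `[U t U] = r(t)`,
  `heckeOperator_rightTranslation_glOne`; the uniformiser may be changed inside `K(𝔫)`,
  `heckeDiagAt_inv_mul_heckeDiagAt_mem_principalCongruenceLevel`); with
  `BigHeckeGLn.ofFinite_heckeElement_one`, `BigHeckeGLn.valued_uniformizerAt` relating the Hecke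
  elements of `CompletedCohomologyHeckeAlgebraGLn` and of `GLnAdelicStructure`.
The assembly with the cohomological side (`GLnCohomology.cuspidalEigenclass_exists_rank_one`, the
named fact for `n = 1`) is the sequel `CuspidalCohomologyGLRankOneHolds`.  Only `n = 1` is treated;
for `n ≥ 2` the fact is the Eichler–Shimura–Borel comparison and remains a named fact.

## References

* A. Raghuram, F. Shahidi, *On certain period relations for cusp forms on `GL_n`*, Int. Math.
  Res. Not. IMRN 2008, Art. ID rnn077 (doi:10.1093/imrn/rnn077; arXiv:0707.1708), §2.2
  [RaghuramShahidi2010].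
* S. Gelbart, *Automorphic forms on adele groups*, Ann. of Math. Stud. 83 (1975), §2.A
  [Gelbart1975].
* A. Borel, H. Jacquet, *Automorphic forms and automorphic representations*, Proc. Sympos. Pure
  Math. 33 (Corvallis 1979), Part 1, §4.6, 5.7 [BorelJacquet1979].
* L. Clozel, *Motifs et formes automorphes* (1990), §3.3 [Clozel1990].
* P. Cartier, *Representations of `p`-adic groups*, Corvallis (1979), §IV.1 [CartierCorvallis1979].
-/

noncomputable section

open scoped MatrixGroups Matrix Classical
open NumberField NumberField.mixedEmbedding IsDedekindDomain NormedSpace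

namespace Literature.NumberTheory.Automorphic

/-! ### A linear ODE: Jordan chains along a one-parameter group -/

section ODE

/-- **Solutions of a Jordan chain of linear ODEs are exponential polynomials.** If
`u_0, …, u_k : ℝ → ℂ` satisfy `u_j' = μ u_j + u_{j+1}` (`j < k`) and `u_k = 0`, then
`u_0(t) = e^{μ t} ∑_{j<k} (t^j / j!) u_j(0)`. (Induction on `k`: `u_1` is known by induction, and
`t ↦ e^{-μ t} u_0(t) - ∑_{j<k} t^{j+1}/(j+1)! · u_{j+1}(0)` has derivative zero.) [folklore] -/
theorem eq_exp_mul_sum_of_hasDerivAt_chain (μ : ℂ) :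
    ∀ (k : ℕ) (u : ℕ → ℝ → ℂ),
      (∀ j < k, ∀ t : ℝ, HasDerivAt (u j) (μ * u j t + u (j + 1) t) t) → (∀ t, u k t = 0) →
        ∀ t : ℝ, u 0 t = Complex.exp (μ * t) *
          ∑ j ∈ Finset.range k, ((t : ℂ) ^ j / (j.factorial : ℂ)) * u j 0 := by
  intro k
  induction k with
  | zero =>
    intro u _ hk t
    rw [Finset.sum_range_zero, mul_zero]
    exact hk t
  | succ k ih =>
    intro u hu hk t
    -- the shifted chain
    have h1 : ∀ s : ℝ, u 1 s = Complex.exp (μ * s) *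
        ∑ j ∈ Finset.range k, ((s : ℂ) ^ j / (j.factorial : ℂ)) * u (j + 1) 0 :=
      ih (fun j => u (j + 1)) (fun j hj s => hu (j + 1) (by omega) s) hk
    -- `w(s) = e^{-μ s} u_0(s) - ∑_{j<k} s^{j+1}/(j+1)! u_{j+1}(0)` is constant
    set c : ℕ → ℂ := fun j => u (j + 1) 0 with hc
    set w : ℝ → ℂ := fun s => Complex.exp (-(μ * s)) * u 0 s -
      ∑ j ∈ Finset.range k, ((s : ℂ) ^ (j + 1) / ((j + 1).factorial : ℂ)) * c j with hw
    have hexp : ∀ s : ℝ, HasDerivAt (fun s : ℝ => Complex.exp (-(μ * s)))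
        (Complex.exp (-(μ * s)) * (-μ)) s := fun s => by
      have h0 : HasDerivAt (fun y : ℝ => -μ * ((y : ℝ) : ℂ)) (-μ * 1) s :=
        ((hasDerivAt_id s).ofReal_comp).const_mul (-μ)
      have hf : (fun y : ℝ => -μ * ((y : ℝ) : ℂ)) = fun s : ℝ => -(μ * (s : ℂ)) := by
        funext y; rw [neg_mul]
      rw [hf, mul_one] at h0
      exact h0.cexp
    have hpow : ∀ (j : ℕ) (s : ℝ), HasDerivAt (fun s : ℝ => ((s : ℂ) ^ (j + 1) / ((j + 1).factorial : ℂ)))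
        ((s : ℂ) ^ j / (j.factorial : ℂ)) s := fun j s => by
      have h0 : HasDerivAt (fun y : ℝ => ((y : ℝ) : ℂ) ^ (j + 1)) (((j + 1 : ℕ) : ℂ) * (s : ℂ) ^ j) s := by
        have h := (hasDerivAt_pow (j + 1) (s : ℂ)).comp_ofReal
        rwa [Nat.add_sub_cancel] at h
      have h1 := h0.div_const ((j + 1).factorial : ℂ)
      refine h1.congr_deriv ?_
      rw [Nat.factorial_succ, Nat.cast_mul]
      have hj : ((j.factorial : ℕ) : ℂ) ≠ 0 := Nat.cast_ne_zero.mpr (Nat.factorial_ne_zero j)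
      have hj1 : ((j + 1 : ℕ) : ℂ) ≠ 0 := Nat.cast_ne_zero.mpr (Nat.succ_ne_zero j)
      field_simp
    have hw' : ∀ s, HasDerivAt w 0 s := by
      intro s
      have hA : HasDerivAt (fun s : ℝ => Complex.exp (-(μ * s)) * u 0 s)
          (Complex.exp (-(μ * s)) * (-μ) * u 0 s + Complex.exp (-(μ * s)) * (μ * u 0 s + u 1 s)) s :=
        (hexp s).mul (hu 0 (Nat.succ_pos k) s)
      have hB : HasDerivAt (fun s : ℝ => ∑ j ∈ Finset.range k,
          ((s : ℂ) ^ (j + 1) / ((j + 1).factorial : ℂ)) * c j)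
          (∑ j ∈ Finset.range k, ((s : ℂ) ^ j / (j.factorial : ℂ)) * c j) s :=
        HasDerivAt.fun_sum fun j _ => (hpow j s).mul_const (c j)
      refine (hA.sub hB).congr_deriv ?_
      rw [h1 s]
      have he : Complex.exp (-(μ * s)) * Complex.exp (μ * s) = 1 := by
        rw [← Complex.exp_add, neg_add_cancel, Complex.exp_zero]
      calc Complex.exp (-(μ * ↑s)) * -μ * u 0 s +
            Complex.exp (-(μ * ↑s)) * (μ * u 0 s + Complex.exp (μ * ↑s) *
              ∑ j ∈ Finset.range k, (↑s) ^ j / ↑j.factorial * u (j + 1) 0) -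
            ∑ j ∈ Finset.range k, (↑s) ^ j / ↑j.factorial * c j
          = (Complex.exp (-(μ * ↑s)) * Complex.exp (μ * ↑s)) *
              ∑ j ∈ Finset.range k, (↑s) ^ j / ↑j.factorial * u (j + 1) 0 -
            ∑ j ∈ Finset.range k, (↑s) ^ j / ↑j.factorial * c j := by ring
        _ = 0 := by rw [he, one_mul, hc, sub_self]
    have hconst := is_const_of_deriv_eq_zero (fun s => (hw' s).differentiableAt)
      (fun s => (hw' s).deriv) t 0
    have hw0 : w 0 = u 0 0 := by
      simp only [hw, Complex.ofReal_zero, mul_zero, neg_zero, Complex.exp_zero, one_mul]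
      rw [Finset.sum_eq_zero fun j _ => by rw [zero_pow (Nat.succ_ne_zero j), zero_div, zero_mul],
        sub_zero]
    rw [hw0] at hconst
    -- solve for `u 0 t`
    have he : Complex.exp (μ * t) * Complex.exp (-(μ * t)) = 1 := by
      rw [← Complex.exp_add, add_neg_cancel, Complex.exp_zero]
    have hu0 : u 0 t = Complex.exp (μ * t) * (u 0 0 +
        ∑ j ∈ Finset.range k, ((t : ℂ) ^ (j + 1) / ((j + 1).factorial : ℂ)) * c j) := by
      rw [← hconst]
      simp only [hw]
      rw [sub_add_cancel, ← mul_assoc, he, one_mul]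
    rw [hu0]
    congr 1
    rw [Finset.sum_range_succ']
    simp only [hc, pow_zero, Nat.factorial_zero, Nat.cast_one, div_one, one_mul]
    rw [add_comm]

end ODE

/-! ### The quasi-character of an automorphic representation of `GL₁(𝔸_K)` -/

section QuasiCharacter

variable {K : Type} [Field K] [NumberField K]
  {A : Type*} [NormedCommRing A] [NormedAlgebra ℝ A] [NormedAlgebra ℚ A] [CompleteSpace A]
  [StarRing A] {N : Type*} [Fintype N] [DecidableEq N]
  {𝒢 : AdelicGroupData K} {𝒟 : AutomorphyDatum 𝒢 A N}

/-- **The scalar by which an operator acts on `W / W'` is read off any vector outside `W'`**: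
if `T φ - a φ ∈ W'` for all `φ ∈ W` and `T ψ - b ψ ∈ W'` for one `ψ ∈ W ∖ W'`, then `a = b`.
Borel–Jacquet 1979, 4.6. [folklore] -/
theorem AutomorphicRepData.eq_of_sub_smul_mem (π : AutomorphicRepData 𝒟)
    {T : (𝒢.Adelic → ℂ) → (𝒢.Adelic → ℂ)} {a b : ℂ} (ha : ∀ φ ∈ π.W, T φ - a • φ ∈ π.W')
    {ψ : 𝒢.Adelic → ℂ} (hψ : ψ ∈ π.W) (hψ' : ψ ∉ π.W') (hb : T ψ - b • ψ ∈ π.W') : a = b := by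
  by_contra hab
  have hmem : (b - a) • ψ ∈ π.W' := by
    have := π.W'.sub_mem (ha ψ hψ) hb
    rwa [sub_sub_sub_cancel_left, ← sub_smul] at this
  have hba : b - a ≠ 0 := sub_ne_zero.2 (Ne.symm hab)
  exact hψ' (by simpa [hba] using π.W'.smul_mem (b - a)⁻¹ hmem)

variable {hcpt : isCompact_glFiniteIntegralLevel 1 K}

/-- **The quasi-character of an automorphic representation of `GL₁(𝔸_K)`.** For every
automorphic representation `π = W / W'` of `GL₁(𝔸_K)` in the sense of Borel–Jacquet there is a
homomorphism `ω_π : GL₁(𝔸_K) → ℂˣ` such that every `g ∈ GL₁(𝔸_K)` acts on the line `W / W'` by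
`ω_π(g)`: `r(g) φ - ω_π(g) φ ∈ W'` for all `φ ∈ W` (each `g` acts by a scalar,
`AutomorphicRepData.exists_rightTranslation_sub_smul_mem_glOne'`; the scalars are unique,
multiplicative since `r(gh) = r(g) r(h)` with `W'` stable under `r(g)`, and non-zero since `g` is
invertible).  Automorphic representations of `GL(1)` "are" these quasi-characters of `𝔸_Kˣ`.
Gelbart (1975), §2.A; Borel–Jacquet 1979, 4.6. [cite: Gelbart1975, §2.A] -/
theorem AutomorphicRepData.exists_quasiCharacter_glOne
    (π : AutomorphicRepData (AutomorphyDatum.gl 1 K hcpt)) :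
    ∃ ω : (AdelicGroupData.gl 1 K).Adelic →* ℂˣ, ∀ (g : (AdelicGroupData.gl 1 K).Adelic),
      ∀ φ ∈ π.W, rightTranslation (AdelicGroupData.gl 1 K) g φ - ((ω g : ℂˣ) : ℂ) • φ ∈ π.W' := by
  choose c hc using π.exists_rightTranslation_sub_smul_mem_glOne'
  obtain ⟨ψ, hψW, hψW'⟩ := SetLike.exists_of_lt π.lt
  have h1 : c 1 = 1 :=
    π.eq_of_sub_smul_mem (hc 1) hψW hψW' (by
      rw [map_one, one_smul, Module.End.one_apply, sub_self]; exact π.W'.zero_mem)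
  have hmul : ∀ g h, c (g * h) = c g * c h := fun g h =>
    π.eq_of_sub_smul_mem (hc (g * h)) hψW hψW' (by
      have e : rightTranslation (AdelicGroupData.gl 1 K) (g * h) ψ - (c g * c h) • ψ =
          rightTranslation (AdelicGroupData.gl 1 K) g
              (rightTranslation (AdelicGroupData.gl 1 K) h ψ - c h • ψ) +
            c h • (rightTranslation (AdelicGroupData.gl 1 K) g ψ - c g • ψ) := by
        rw [map_mul, Module.End.mul_apply, map_sub, map_smul, smul_sub, smul_smul, mul_comm (c h)]
        abel
      rw [e]
      exact π.W'.add_mem (π.stable'.rightTranslation_mem_glOne g (hc h ψ hψW))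
        (π.W'.smul_mem _ (hc g ψ hψW)))
  let c' : (AdelicGroupData.gl 1 K).Adelic →* ℂ :=
    { toFun := c, map_one' := h1, map_mul' := hmul }
  exact ⟨c'.toHomUnits, fun g φ hφ => hc g φ hφ⟩

/-- **The quasi-character is trivial on `GL₁(K)`**: forms are left `GL₁(K)`-invariant and
`GL₁(𝔸_K)` is commutative, so `r(γ) φ = φ` for `γ ∈ GL₁(K)`. Gelbart (1975), §2.A.
[cite: Gelbart1975, §2.A] -/
theorem AutomorphicRepData.rightTranslation_toAdelic_eq_glOne
    (π : AutomorphicRepData (AutomorphyDatum.gl 1 K hcpt)) (γ : (AdelicGroupData.gl 1 K).Rational)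
    {φ : (AdelicGroupData.gl 1 K).Adelic → ℂ} (hφ : φ ∈ π.W) :
    rightTranslation (AdelicGroupData.gl 1 K) ((AdelicGroupData.gl 1 K).toAdelic γ) φ = φ := by
  have hleft : IsLeftInvariant (AdelicGroupData.gl 1 K) φ :=
    (isAutomorphicForm_of_mem_automorphicForms_gl (π.stable.le_automorphicForms hφ)).leftInvariant
  funext g
  rw [rightTranslation_apply]
  exact (congrArg φ (AdelicGroupData.gl_one_mul_comm (K := K) g _)).trans (hleft _ ⟨γ, rfl⟩ g)

end QuasiCharacter

/-! ### One-parameter subgroups act on `W / W'` through `exp` -/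

section OneParameter

variable {K : Type} [Field K] [NumberField K] {hcpt : isCompact_glFiniteIntegralLevel 1 K}

/-- Iterates of `ψ ↦ X ψ - d ψ` stay in a stable subspace. [folklore] -/
theorem IsStableSubmodule.iterate_lieDeriv_sub_smul_mem
    {W : Submodule ℂ ((AdelicGroupData.gl 1 K).Adelic → ℂ)}
    (hW : IsStableSubmodule (AutomorphyDatum.gl 1 K hcpt) W) (X : (AutomorphyDatum.gl 1 K hcpt).arch.lie)
    (d : ℂ) (k : ℕ) {φ : (AdelicGroupData.gl 1 K).Adelic → ℂ} (hφ : φ ∈ W) :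
    (fun ψ => lieDeriv (AutomorphyDatum.gl 1 K hcpt).ofArch X ψ - d • ψ)^[k] φ ∈ W := by
  induction k with
  | zero => exact hφ
  | succ k ih =>
    rw [Function.iterate_succ_apply']
    exact W.sub_mem (hW.lie_stable X _ ih) (W.smul_mem d ih)

/-- **A generalised eigenvector outside `W'`.** Let `π = W / W'` be an automorphic representation
of `GL₁(𝔸_K)` and suppose `X ∈ 𝔤𝔩₁(K_∞)` acts on the line `W / W'` by the scalar `d`
(`X φ - d φ ∈ W'`).  Then some `φ₁ ∈ W ∖ W'` is killed by a power of `X - d`: in the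
finite-dimensional `Z(𝔤)`-orbit span `V ⊆ W` of any `φ ∈ W ∖ W'` (stable under `X`, which is
central), the generalised eigenspaces of `X` for eigenvalues `ν ≠ d` lie in `W'` (on `W / W'`,
`(X - ν)^k` acts by `(d - ν)^k ≠ 0`), and they span `V` together with the one for `ν = d`
(Mathlib `Module.End.iSup_maxGenEigenspace_eq_top`), which therefore is not inside `W'`.
[folklore] -/
theorem AutomorphicRepData.exists_iterate_lieDeriv_sub_smul_eq_zero_glOne
    (π : AutomorphicRepData (AutomorphyDatum.gl 1 K hcpt)) (X : (AutomorphyDatum.gl 1 K hcpt).arch.lie)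
    {d : ℂ} (hd : ∀ φ ∈ π.W, lieDeriv (AutomorphyDatum.gl 1 K hcpt).ofArch X φ - d • φ ∈ π.W') :
    ∃ φ₁ ∈ π.W, φ₁ ∉ π.W' ∧ ∃ k : ℕ,
      (fun ψ => lieDeriv (AutomorphyDatum.gl 1 K hcpt).ofArch X ψ - d • ψ)^[k] φ₁ = 0 := by
  set ι := (AutomorphyDatum.gl 1 K hcpt).ofArch with hι
  obtain ⟨φ, hφW, hφW'⟩ := SetLike.exists_of_lt π.lt
  have hφform : IsAutomorphicForm (AutomorphyDatum.gl 1 K hcpt) φ :=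
    isAutomorphicForm_of_mem_automorphicForms_gl (π.stable.le_automorphicForms hφW)
  have hφs : IsArchSmooth ι φ := hφform.archSmooth
  set V := zOrbitSpan ι φ with hV
  haveI : FiniteDimensional ℂ V := hφform.zFinite
  have hVW : V ≤ π.W := Submodule.span_le.2 (by
    rintro _ ⟨p, -, rfl⟩
    exact π.stable.applyFree_mem p hφW)
  have hVs : ∀ ψ ∈ V, IsArchSmooth ι ψ := fun ψ hψ => isArchSmooth_of_mem_zOrbitSpan ι hφs hψ
  have hVX : ∀ ψ ∈ V, lieDeriv ι X ψ ∈ V :=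
    fun ψ hψ => lieDeriv_mem_zOrbitSpan_of_forall_lie_eq_zero ι (glOne_lie_eq_zero X) hφs hψ
  -- the Lie derivative along `X` as an endomorphism of `V`
  let T : Module.End ℂ V :=
    { toFun := fun v => ⟨lieDeriv ι X v, hVX v v.2⟩
      map_add' := fun v w => Subtype.ext (IsArchSmooth.lieDeriv_add ι X (hVs _ v.2) (hVs _ w.2))
      map_smul' := fun c v => Subtype.ext (by
        change lieDeriv ι X (c • (v : (AdelicGroupData.gl 1 K).Adelic → ℂ)) =
          c • lieDeriv ι X (v : (AdelicGroupData.gl 1 K).Adelic → ℂ)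
        exact lieDeriv_smul X c _) }
  have hT : ∀ (ν : ℂ) (v : V), (((T - ν • (1 : Module.End ℂ V)) v : V) : (AdelicGroupData.gl 1 K).Adelic → ℂ) =
      lieDeriv ι X v - ν • (v : (AdelicGroupData.gl 1 K).Adelic → ℂ) := fun ν v => rfl
  -- powers of `T - ν` act on `W / W'` by powers of `d - ν`
  have hpow : ∀ (ν : ℂ) (k : ℕ) (v : V),
      ((((T - ν • (1 : Module.End ℂ V)) ^ k) v : V) : (AdelicGroupData.gl 1 K).Adelic → ℂ) -
        (d - ν) ^ k • (v : (AdelicGroupData.gl 1 K).Adelic → ℂ) ∈ π.W' := by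
    intro ν k
    induction k with
    | zero =>
      intro v
      rw [pow_zero, Module.End.one_apply, pow_zero, one_smul, sub_self]
      exact π.W'.zero_mem
    | succ k ih =>
      intro v
      rw [pow_succ', Module.End.mul_apply, hT]
      set z : V := ((T - ν • (1 : Module.End ℂ V)) ^ k) v with hz
      have hzW : (z : (AdelicGroupData.gl 1 K).Adelic → ℂ) ∈ π.W := hVW z.2
      have e : lieDeriv ι X z - ν • (z : (AdelicGroupData.gl 1 K).Adelic → ℂ) -
          (d - ν) ^ (k + 1) • (v : (AdelicGroupData.gl 1 K).Adelic → ℂ) =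
          (lieDeriv ι X z - d • (z : (AdelicGroupData.gl 1 K).Adelic → ℂ)) +
            (d - ν) • ((z : (AdelicGroupData.gl 1 K).Adelic → ℂ) -
              (d - ν) ^ k • (v : (AdelicGroupData.gl 1 K).Adelic → ℂ)) := by
        rw [pow_succ', smul_sub, smul_smul, sub_smul d ν (z : (AdelicGroupData.gl 1 K).Adelic → ℂ)]
        abel
      rw [e]
      exact π.W'.add_mem (hd _ hzW) (π.W'.smul_mem _ (ih v))
  -- generalised eigenspaces for `ν ≠ d` lie in `W'`
  set V' : Submodule ℂ V := π.W'.comap V.subtype with hV'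
  have hle : ∀ ν : ℂ, ν ≠ d → T.maxGenEigenspace ν ≤ V' := by
    intro ν hν v hv
    obtain ⟨k, hk⟩ := (Module.End.mem_maxGenEigenspace T ν v).1 hv
    have h := hpow ν k v
    rw [hk, ZeroMemClass.coe_zero, zero_sub, neg_mem_iff] at h
    have hne : (d - ν) ^ k ≠ 0 := pow_ne_zero _ (sub_ne_zero.2 (Ne.symm hν))
    change (v : (AdelicGroupData.gl 1 K).Adelic → ℂ) ∈ π.W'
    have h' := π.W'.smul_mem ((d - ν) ^ k)⁻¹ h
    rwa [smul_smul, inv_mul_cancel₀ hne, one_smul] at h'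
  -- hence the one for `ν = d` does not
  have hnot : ¬ T.maxGenEigenspace d ≤ V' := by
    intro hdle
    have htop : (⊤ : Submodule ℂ V) ≤ V' := by
      rw [← Module.End.iSup_maxGenEigenspace_eq_top T]
      refine iSup_le fun ν => ?_
      by_cases hν : ν = d
      · subst hν; exact hdle
      · exact hle ν hν
    have hφV : φ ∈ V := mem_zOrbitSpan_self ι φ
    exact hφW' (htop (Submodule.mem_top : (⟨φ, hφV⟩ : V) ∈ ⊤))
  obtain ⟨v, hv, hvV'⟩ := Set.not_subset.1 hnot
  obtain ⟨k, hk⟩ := (Module.End.mem_maxGenEigenspace T d v).1 hv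
  refine ⟨v, hVW v.2, hvV', k, ?_⟩
  -- the iterate on functions is the power on `V`
  have hiter : ∀ (k : ℕ) (v : V),
      (fun ψ => lieDeriv ι X ψ - d • ψ)^[k] (v : (AdelicGroupData.gl 1 K).Adelic → ℂ) =
        ((((T - d • (1 : Module.End ℂ V)) ^ k) v : V) : (AdelicGroupData.gl 1 K).Adelic → ℂ) := by
    intro k
    induction k with
    | zero => intro v; rfl
    | succ k ih =>
      intro v
      rw [Function.iterate_succ_apply', ih, pow_succ', Module.End.mul_apply, hT]
  rw [hiter, hk, ZeroMemClass.coe_zero]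

/-- **One-parameter subgroups act on `W / W'` through `exp`.** Let `π = W / W'` be an
automorphic representation of `GL₁(𝔸_K)` and let `X ∈ 𝔤𝔩₁(K_∞)` act on `W / W'` by the scalar
`d` (`X φ - d φ ∈ W'` for `φ ∈ W`).  Then `r(exp tX) φ - e^{d t} φ ∈ W'` for all `φ ∈ W` and
`t ∈ ℝ`: for a generalised eigenvector `φ₁ ∈ W ∖ W'`, `(X - d)^k φ₁ = 0`
(`exists_iterate_lieDeriv_sub_smul_eq_zero_glOne`), the functions
`u_j(t) = ((X - d)^j φ₁)(g exp tX)` form a Jordan chain of ODEs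
(`IsArchSmooth.hasDerivAt_flow`), so `φ₁(g exp tX) = e^{dt} ∑_{j<k} t^j/j! ((X-d)^j φ₁)(g)`
(`eq_exp_mul_sum_of_hasDerivAt_chain`) with `(X - d)^j φ₁ ∈ W'` for `j ≥ 1`; the scalar by which
`r(exp tX)` acts on the line `W / W'` (`exists_rightTranslation_sub_smul_mem_glOne'`) is
therefore `e^{dt}`.  (For `W' = ⊥` this is `AutomorphicRepData.exists_apply_posRealScalar_mul_eq_cpow`.)
Borel–Jacquet 1979, 4.6 and 5.7; Gelbart (1975), §2.A. [cite: Gelbart1975, §2.A] -/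
theorem AutomorphicRepData.rightTranslation_expMem_sub_exp_smul_mem_glOne
    (π : AutomorphicRepData (AutomorphyDatum.gl 1 K hcpt)) (X : (AutomorphyDatum.gl 1 K hcpt).arch.lie)
    {d : ℂ} (hd : ∀ φ ∈ π.W, lieDeriv (AutomorphyDatum.gl 1 K hcpt).ofArch X φ - d • φ ∈ π.W')
    (t : ℝ) {φ : (AdelicGroupData.gl 1 K).Adelic → ℂ} (hφ : φ ∈ π.W) :
    rightTranslation (AdelicGroupData.gl 1 K)
        ((AutomorphyDatum.gl 1 K hcpt).ofArch ((AutomorphyDatum.gl 1 K hcpt).arch.expMem (t • X))) φ -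
      Complex.exp (d * t) • φ ∈ π.W' := by
  obtain ⟨φ₁, hφ₁W, hφ₁W', k, hk⟩ := π.exists_iterate_lieDeriv_sub_smul_eq_zero_glOne X hd
  -- the Jordan chain `ψ_j = (X - d)^j φ₁`
  let ψ : ℕ → (AdelicGroupData.gl 1 K).Adelic → ℂ :=
    fun j => (fun ψ => lieDeriv (AutomorphyDatum.gl 1 K hcpt).ofArch X ψ - d • ψ)^[j] φ₁
  have hψW : ∀ j, ψ j ∈ π.W := fun j => π.stable.iterate_lieDeriv_sub_smul_mem X d j hφ₁W
  have hψs : ∀ j, IsArchSmooth (AutomorphyDatum.gl 1 K hcpt).ofArch (ψ j) := fun j =>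
    (isAutomorphicForm_of_mem_automorphicForms_gl (π.stable.le_automorphicForms (hψW j))).archSmooth
  have hψsucc : ∀ j, ψ (j + 1) = lieDeriv (AutomorphyDatum.gl 1 K hcpt).ofArch X (ψ j) - d • ψ j :=
    fun j => Function.iterate_succ_apply' _ j φ₁
  have hψderiv : ∀ j, lieDeriv (AutomorphyDatum.gl 1 K hcpt).ofArch X (ψ j) = d • ψ j + ψ (j + 1) :=
    fun j => by rw [hψsucc, add_sub_cancel]
  have hψW' : ∀ j, ψ (j + 1) ∈ π.W' := fun j => by rw [hψsucc]; exact hd _ (hψW j)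
  have hψ0 : ψ 0 = φ₁ := rfl
  have hψk : ψ k = 0 := hk
  -- `k ≠ 0` since `φ₁ ≠ 0`
  obtain ⟨m, rfl⟩ : ∃ m, k = m + 1 := by
    refine Nat.exists_eq_add_one_of_ne_zero ?_
    rintro rfl
    exact hφ₁W' (by rw [← hψ0, hψk]; exact π.W'.zero_mem)
  -- the flow formula for `φ₁`
  have hflow : ∀ g : (AdelicGroupData.gl 1 K).Adelic,
      φ₁ (g * (AutomorphyDatum.gl 1 K hcpt).ofArch ((AutomorphyDatum.gl 1 K hcpt).arch.expMem (t • X))) =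
        Complex.exp (d * t) * ∑ j ∈ Finset.range (m + 1), ((t : ℂ) ^ j / (j.factorial : ℂ)) * ψ j g := by
    intro g
    have h0 : ∀ j, ψ j (g * (AutomorphyDatum.gl 1 K hcpt).ofArch
        ((AutomorphyDatum.gl 1 K hcpt).arch.expMem ((0 : ℝ) • X))) = ψ j g := fun j => by
      rw [zero_smul, RealMatrixGroup.expMem_zero', map_one, mul_one]
    have h := eq_exp_mul_sum_of_hasDerivAt_chain d (m + 1)
      (fun j s => ψ j (g * (AutomorphyDatum.gl 1 K hcpt).ofArch
        ((AutomorphyDatum.gl 1 K hcpt).arch.expMem (s • X))))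
      (fun j _ s => ((hψs j).hasDerivAt_flow (AutomorphyDatum.gl 1 K hcpt).ofArch X g s).congr_deriv
        (by rw [hψderiv, Pi.add_apply, Pi.smul_apply, smul_eq_mul]))
      (fun s => by rw [hψk]; rfl) t
    simp only [h0] at h
    exact h
  have hmem₁ : rightTranslation (AdelicGroupData.gl 1 K)
      ((AutomorphyDatum.gl 1 K hcpt).ofArch ((AutomorphyDatum.gl 1 K hcpt).arch.expMem (t • X))) φ₁ -
      Complex.exp (d * t) • φ₁ ∈ π.W' := by
    have e : rightTranslation (AdelicGroupData.gl 1 K)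
        ((AutomorphyDatum.gl 1 K hcpt).ofArch ((AutomorphyDatum.gl 1 K hcpt).arch.expMem (t • X))) φ₁ -
        Complex.exp (d * t) • φ₁ =
        Complex.exp (d * t) • ∑ j ∈ Finset.range m,
          ((t : ℂ) ^ (j + 1) / ((j + 1).factorial : ℂ)) • ψ (j + 1) := by
      funext g
      rw [Pi.sub_apply, rightTranslation_apply, hflow g, Finset.sum_range_succ', Pi.smul_apply,
        Pi.smul_apply, Finset.sum_apply]
      simp only [pow_zero, Nat.factorial_zero, Nat.cast_one, div_one, one_mul, hψ0, Pi.smul_apply,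
        smul_eq_mul, mul_add, add_sub_cancel_right]
    rw [e]
    exact π.W'.smul_mem _ (π.W'.sum_mem fun j _ => π.W'.smul_mem _ (hψW' j))
  -- the scalar on the line `W / W'` is `e^{dt}`
  obtain ⟨c, hc⟩ := π.exists_rightTranslation_sub_smul_mem_glOne'
    ((AutomorphyDatum.gl 1 K hcpt).ofArch ((AutomorphyDatum.gl 1 K hcpt).arch.expMem (t • X)))
  have hceq : c = Complex.exp (d * t) := π.eq_of_sub_smul_mem hc hφ₁W hφ₁W' hmem₁
  rw [← hceq]
  exact hc φ hφ

end OneParameter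

/-! ### `K = ℚ`: the archimedean exponent of a representation of cohomological infinity type -/

section Rat

variable {hcpt : isCompact_glFiniteIntegralLevel 1 ℚ}

/-- `ℚ` has no complex place. [folklore] -/
theorem isEmpty_isComplex_rat : IsEmpty {w : InfinitePlace ℚ // w.IsComplex} :=
  ⟨fun w => (InfinitePlace.not_isReal_iff_isComplex.mpr w.2)
    (by rw [Subsingleton.elim w.1 Rat.infinitePlace]; exact Rat.isReal_infinitePlace)⟩

/-- For `K = ℚ` the element `1_w ∈ 𝔤𝔩₁(ℚ_∞)` at the (unique, real) infinite place `w` is the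
identity `1 ∈ 𝔤𝔩₁(ℚ_∞)`. [folklore] -/
theorem realPlaceLie_one_one_rat (w : {w : InfinitePlace ℚ // w.IsReal}) :
    realPlaceLie 1 w (1 : Matrix (Fin 1) (Fin 1) ℝ) = 1 := by
  haveI := isEmpty_isComplex_rat
  refine Matrix.ext fun i j => ?_
  rw [Subsingleton.elim i 0, Subsingleton.elim j 0, realPlaceLie_apply, Matrix.one_apply_eq,
    Matrix.one_apply_eq]
  refine Prod.ext (funext fun w' => ?_) (Subsingleton.elim _ _)
  rw [Subsingleton.elim w' w]
  change (Pi.single w (1 : ℝ) : {w : InfinitePlace ℚ // w.IsReal} → ℝ) w = 1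
  rw [Pi.single_eq_same]

/-- **The archimedean exponent from the infinity type (`K = ℚ`).** If an automorphic
representation `π = W / W'` of `GL₁(𝔸_ℚ)` has the cohomological infinity type of the weight
`λ = (λ₀)` (`cohomologicalInfinityType 1 ℚ λ`: `a`-exponent `λ₀ + ρ₀ = λ₀`), then the central
element `1 ∈ 𝔤𝔩₁(ℝ)` acts on `W / W'` by `λ₀`: `1 φ - λ₀ φ ∈ W'`.  (The Lie algebra acts on the
line `W / W'` through a linear form `d`, `exists_linearMap_lieAction_eq_smul_one_glOne`, whose
value at `1 = 1_w` is the archimedean parameter, `hasArchParameter_glOne_of_eq_smul_one`, and the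
parameter is unique, `hasArchParameter_unique`.) Clozel (1990), §3.3; Borel–Wallach III 1.5.
[cite: Clozel1990, §3.3] -/
theorem AutomorphicRepData.lieDeriv_one_sub_smul_mem_of_hasInfinityType_rat
    (π : AutomorphicRepData (AutomorphyDatum.gl 1 ℚ hcpt)) {wt : Fin 1 → ℤ}
    (hT : π.HasInfinityType (Literature.Barriers.Langlands.cohomologicalInfinityType 1 ℚ wt))
    {φ : (AdelicGroupData.gl 1 ℚ).Adelic → ℂ} (hφ : φ ∈ π.W) :
    lieDeriv (AutomorphyDatum.gl 1 ℚ hcpt).ofArch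
        (⟨1, trivial⟩ : (AutomorphyDatum.gl 1 ℚ hcpt).arch.lie) φ - ((wt 0 : ℤ) : ℂ) • φ ∈ π.W' := by
  haveI := isEmpty_isComplex_rat
  obtain ⟨ρ𝔤, hρ⟩ := π.exists_hasLieAction_gl
  obtain ⟨d, hd⟩ := π.exists_linearMap_lieAction_eq_smul_one_glOne ρ𝔤
  let w₀ : {w : InfinitePlace ℚ // w.IsReal} := ⟨Rat.infinitePlace, Rat.isReal_infinitePlace⟩
  set X₁ : (AutomorphyDatum.gl 1 ℚ hcpt).arch.lie := ⟨realPlaceLie 1 w₀ 1, trivial⟩ with hX₁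
  -- the archimedean parameter read off `d`
  have hχ : π.HasArchParameter fun _ => {d X₁} :=
    π.hasArchParameter_glOne_of_eq_smul_one hρ d hd
      (fun w => by rw [Subsingleton.elim w w₀]) (fun w => isEmptyElim w)
  -- compare with the given infinity type
  have e := congr_fun (π.hasArchParameter_unique hχ hT.2) (Rat.castHom ℂ)
  have hval : d X₁ = ((wt 0 : ℤ) : ℂ) := by
    have e' : ({d X₁} : Multiset ℂ) = {((wt 0 : ℤ) : ℂ) + rhoGL 1 0} := by
      rw [e, Literature.Barriers.Langlands.cohomologicalInfinityType_apply, Multiset.map_map]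
      rw [show (Finset.univ : Finset (Fin 1)) = {0} from Finset.univ_unique]
      rfl
    rw [rhoGL_one, add_zero] at e'
    exact Multiset.singleton_inj.mp e'
  -- `X₁ = 1`
  have hX : X₁ = (⟨1, trivial⟩ : (AutomorphyDatum.gl 1 ℚ hcpt).arch.lie) :=
    Subtype.ext (realPlaceLie_one_one_rat w₀)
  -- the Lie algebra action on `W / W'`
  have hq : π.mkQ (π.lieDerivW X₁ ⟨φ, hφ⟩) = π.mkQ (d X₁ • ⟨φ, hφ⟩) := by
    rw [← hρ X₁ ⟨φ, hφ⟩, hd X₁, map_smul]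
    rfl
  have hmem : π.lieDerivW X₁ ⟨φ, hφ⟩ - d X₁ • ⟨φ, hφ⟩ ∈ π.kerQuot := (Submodule.Quotient.eq _).mp hq
  rw [← hX, ← hval]
  exact hmem

/-- `realToInfiniteAdele ℚ` agrees with `algebraMap ℚ ℚ_∞` on rationals (`ℚ` has one infinite
place, which is real, and every ring homomorphism `ℚ → ℝ` is the cast). [folklore] -/
theorem realToInfiniteAdele_ratCast (q : ℚ) :
    realToInfiniteAdele ℚ (q : ℝ) = algebraMap ℚ (InfiniteAdeleRing ℚ) q := by
  haveI := isEmpty_isComplex_rat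
  change (InfiniteAdeleRing.ringEquiv_mixedSpace ℚ).symm (algebraMap ℝ (mixedSpace ℚ) (q : ℝ)) = _
  rw [RingEquiv.symm_apply_eq, ← InfiniteAdeleRing.mixedEmbedding_eq_algebraMap_comp]
  refine Prod.ext (funext fun w => ?_) (Subsingleton.elim _ _)
  rw [mixedEmbedding_apply_isReal, eq_ratCast]
  rfl

/-- **`GL₁(ℚ)⁺` inside `GL₁(𝔸_ℚ)`**: a rational `γ > 0`, embedded diagonally, is the product of
the positive real scalar `γ_∞ ∈ A_G` (`posRealScalar`) and of its finite part `(1, γ_f)`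
(`GLn.ofFinite` of the diagonal embedding into `GL₁(𝔸_{ℚ,f})`). [folklore] -/
theorem toAdelic_eq_posRealScalar_mul_ofFinite_rat (γ : Matrix.GLPos (Fin 1) ℚ)
    (h0 : (0 : ℝ) < (((γ : GL (Fin 1) ℚ) : Matrix (Fin 1) (Fin 1) ℚ) 0 0 : ℚ)) :
    (AdelicGroupData.gl 1 ℚ).toAdelic (γ : GL (Fin 1) ℚ) =
      (show (AdelicGroupData.gl 1 ℚ).Adelic from
        posRealScalar 1 ℚ (Units.mk0 ⟨_, h0.le⟩ (ne_of_gt (NNReal.coe_pos.mp h0))) *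
          GLn.ofFinite 1 ℚ (BigHeckeGLn.globalEmbedding 1 ℚ (γ : GL (Fin 1) ℚ))) := by
  set q : ℚ := ((γ : GL (Fin 1) ℚ) : Matrix (Fin 1) (Fin 1) ℚ) 0 0 with hq
  set t : NNRealˣ := Units.mk0 ⟨_, h0.le⟩ (ne_of_gt (NNReal.coe_pos.mp h0)) with ht
  -- entries of the three matrices
  have hL : ((show GL (Fin 1) (AdeleRing (𝓞 ℚ) ℚ) from (AdelicGroupData.gl 1 ℚ).toAdelic (γ : GL (Fin 1) ℚ)) :
      Matrix (Fin 1) (Fin 1) (AdeleRing (𝓞 ℚ) ℚ)) 0 0 = algebraMap ℚ (AdeleRing (𝓞 ℚ) ℚ) q := rfl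
  have hP : ((posRealScalar 1 ℚ t : GL (Fin 1) (AdeleRing (𝓞 ℚ) ℚ)) :
      Matrix (Fin 1) (Fin 1) (AdeleRing (𝓞 ℚ) ℚ)) 0 0 =
      ((posRealIdele ℚ t : (AdeleRing (𝓞 ℚ) ℚ)ˣ) : AdeleRing (𝓞 ℚ) ℚ) := by
    rw [posRealScalar, MonoidHom.comp_apply]
    change Matrix.scalar (Fin 1) ((posRealIdele ℚ t : (AdeleRing (𝓞 ℚ) ℚ)ˣ) : AdeleRing (𝓞 ℚ) ℚ) 0 0 = _
    rw [Matrix.scalar_apply, Matrix.diagonal_apply_eq]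
  have hF : ((GLn.ofFinite 1 ℚ (BigHeckeGLn.globalEmbedding 1 ℚ (γ : GL (Fin 1) ℚ)) :
      GL (Fin 1) (AdeleRing (𝓞 ℚ) ℚ)) : Matrix (Fin 1) (Fin 1) (AdeleRing (𝓞 ℚ) ℚ)) 0 0 =
      ((1 : InfiniteAdeleRing ℚ), algebraMap ℚ (FiniteAdeleRing (𝓞 ℚ) ℚ) q) := by
    rw [GLn.coe_ofFinite_apply, Matrix.one_apply_eq]
    rfl
  refine Matrix.GeneralLinearGroup.ext (n := Fin 1) (R := AdeleRing (𝓞 ℚ) ℚ) fun i j => ?_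
  rw [Subsingleton.elim i 0, Subsingleton.elim j 0, hL]
  change _ = (((posRealScalar 1 ℚ t : GL (Fin 1) (AdeleRing (𝓞 ℚ) ℚ)) :
      Matrix (Fin 1) (Fin 1) (AdeleRing (𝓞 ℚ) ℚ)) *
    ((GLn.ofFinite 1 ℚ (BigHeckeGLn.globalEmbedding 1 ℚ (γ : GL (Fin 1) ℚ)) :
      GL (Fin 1) (AdeleRing (𝓞 ℚ) ℚ)) : Matrix (Fin 1) (Fin 1) (AdeleRing (𝓞 ℚ) ℚ))) 0 0
  rw [Matrix.mul_apply, Fin.sum_univ_one, hP, hF]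
  refine Prod.ext ?_ ?_
  · change algebraMap ℚ (InfiniteAdeleRing ℚ) q =
      ((posRealIdele ℚ t : (AdeleRing (𝓞 ℚ) ℚ)ˣ) : AdeleRing (𝓞 ℚ) ℚ).1 * 1
    rw [posRealIdele_fst, mul_one]
    exact (realToInfiniteAdele_ratCast q).symm
  · change algebraMap ℚ (FiniteAdeleRing (𝓞 ℚ) ℚ) q =
      ((posRealIdele ℚ t : (AdeleRing (𝓞 ℚ) ℚ)ˣ) : AdeleRing (𝓞 ℚ) ℚ).2 *
        algebraMap ℚ (FiniteAdeleRing (𝓞 ℚ) ℚ) q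
    rw [posRealIdele_snd, one_mul]

/-- **The finite part of the quasi-character at a positive rational.** Let `π = W / W'` be an
automorphic representation of `GL₁(𝔸_ℚ)` whose central element `1 ∈ 𝔤𝔩₁(ℝ)` acts on `W / W'`
by `s` (`1 φ - s φ ∈ W'`).  Then for a rational `γ > 0` the finite idèle `(1, γ_f)` acts on
`W / W'` by `γ^{-s} = e^{-s log γ}`: `γ = γ_∞ · (1, γ_f)` acts trivially (left invariance,
`rightTranslation_toAdelic_eq_glOne`) and `γ_∞ = exp (log γ · 1)` acts by `e^{s log γ}`
(`rightTranslation_expMem_sub_exp_smul_mem_glOne`, `posRealScalar_eq_ofArch_expMem`).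
Gelbart (1975), §2.A (`χ_f(γ) = χ_∞(γ)⁻¹` for an idèle class character). [cite: Gelbart1975, §2.A] -/
theorem AutomorphicRepData.rightTranslation_ofFinite_rat_sub_smul_mem
    (π : AutomorphicRepData (AutomorphyDatum.gl 1 ℚ hcpt)) {s : ℂ}
    (hs : ∀ φ ∈ π.W, lieDeriv (AutomorphyDatum.gl 1 ℚ hcpt).ofArch
      (⟨1, trivial⟩ : (AutomorphyDatum.gl 1 ℚ hcpt).arch.lie) φ - s • φ ∈ π.W')
    (γ : Matrix.GLPos (Fin 1) ℚ) {φ : (AdelicGroupData.gl 1 ℚ).Adelic → ℂ} (hφ : φ ∈ π.W) :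
    rightTranslation (AdelicGroupData.gl 1 ℚ)
        (show (AdelicGroupData.gl 1 ℚ).Adelic from
          GLn.ofFinite 1 ℚ (BigHeckeGLn.globalEmbedding 1 ℚ (γ : GL (Fin 1) ℚ))) φ -
      Complex.exp (-(s * Real.log ((((γ : GL (Fin 1) ℚ) : Matrix (Fin 1) (Fin 1) ℚ) 0 0 : ℚ) : ℝ))) • φ ∈
        π.W' := by
  have hdet : (0 : ℚ) < (((γ : GL (Fin 1) ℚ) : Matrix (Fin 1) (Fin 1) ℚ) 0 0 : ℚ) := by
    have h := (Matrix.mem_glpos (γ : GL (Fin 1) ℚ)).mp γ.2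
    rwa [Matrix.GeneralLinearGroup.val_det_apply, Matrix.det_fin_one] at h
  have h0 : (0 : ℝ) < ((((γ : GL (Fin 1) ℚ) : Matrix (Fin 1) (Fin 1) ℚ) 0 0 : ℚ) : ℝ) := by exact_mod_cast hdet
  set t : NNRealˣ := Units.mk0 ⟨_, h0.le⟩ (ne_of_gt (NNReal.coe_pos.mp h0)) with ht
  set a : (AdelicGroupData.gl 1 ℚ).Adelic := (show (AdelicGroupData.gl 1 ℚ).Adelic from posRealScalar 1 ℚ t)
    with ha
  set f : (AdelicGroupData.gl 1 ℚ).Adelic :=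
    (show (AdelicGroupData.gl 1 ℚ).Adelic from GLn.ofFinite 1 ℚ (BigHeckeGLn.globalEmbedding 1 ℚ (γ : GL (Fin 1) ℚ)))
    with hf
  -- `a` acts by `e^{s log γ}`
  have hlog : Real.log ((t : NNReal) : ℝ) = Real.log ((((γ : GL (Fin 1) ℚ) : Matrix (Fin 1) (Fin 1) ℚ) 0 0 : ℚ) : ℝ) := rfl
  have ha' : ∀ ψ ∈ π.W, rightTranslation (AdelicGroupData.gl 1 ℚ) a ψ -
      Complex.exp (s * Real.log ((((γ : GL (Fin 1) ℚ) : Matrix (Fin 1) (Fin 1) ℚ) 0 0 : ℚ) : ℝ)) • ψ ∈ π.W' := by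
    intro ψ hψ
    have h := π.rightTranslation_expMem_sub_exp_smul_mem_glOne ⟨1, trivial⟩ hs
      (Real.log ((t : NNReal) : ℝ)) hψ
    rw [← posRealScalar_eq_ofArch_expMem (hcpt := hcpt) t] at h
    exact h
  -- `a * f = γ` acts trivially
  have haf : a * f = (AdelicGroupData.gl 1 ℚ).toAdelic (γ : GL (Fin 1) ℚ) :=
    (toAdelic_eq_posRealScalar_mul_ofFinite_rat γ h0).symm
  have htriv : rightTranslation (AdelicGroupData.gl 1 ℚ) a (rightTranslation (AdelicGroupData.gl 1 ℚ) f φ) = φ := by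
    rw [← Module.End.mul_apply, ← map_mul, haf]
    exact π.rightTranslation_toAdelic_eq_glOne _ hφ
  -- conclude
  have hfφ : rightTranslation (AdelicGroupData.gl 1 ℚ) f φ ∈ π.W := π.stable.rightTranslation_mem_glOne f hφ
  have h1 := ha' _ hfφ
  rw [htriv] at h1
  set E : ℂ := Complex.exp (s * Real.log ((((γ : GL (Fin 1) ℚ) : Matrix (Fin 1) (Fin 1) ℚ) 0 0 : ℚ) : ℝ)) with hE
  have hE0 : E ≠ 0 := Complex.exp_ne_zero _
  have hEinv : Complex.exp (-(s * Real.log ((((γ : GL (Fin 1) ℚ) : Matrix (Fin 1) (Fin 1) ℚ) 0 0 : ℚ) : ℝ))) = E⁻¹ := by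
    rw [hE, Complex.exp_neg]
  -- `φ - E • r(f) φ ∈ W'` gives `r(f) φ - E⁻¹ • φ ∈ W'`
  have h2 : (-E⁻¹) • (φ - E • rightTranslation (AdelicGroupData.gl 1 ℚ) f φ) =
      rightTranslation (AdelicGroupData.gl 1 ℚ) f φ - E⁻¹ • φ := by
    rw [smul_sub, smul_smul, neg_mul, inv_mul_cancel₀ hE0, neg_one_smul, neg_smul, sub_neg_eq_add,
      neg_add_eq_sub]
  rw [hEinv, ← h2]
  exact π.W'.smul_mem _ h1

end Rat

/-! ### The quasi-character at the Hecke elements: Satake parameters -/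

section Satake

variable {K : Type} [Field K] [NumberField K] {hcpt : isCompact_glFiniteIntegralLevel 1 K}

/-- The fixed uniformiser `uniformizerAt v` has valuation `exp(-1)`. [folklore] -/
theorem BigHeckeGLn.valued_uniformizerAt (v : HeightOneSpectrum (𝓞 K)) :
    Valued.v ((BigHeckeGLn.uniformizerAt v : (v.adicCompletion K)ˣ) : v.adicCompletion K) =
      WithZero.exp (-1 : ℤ) := by
  change Valued.v ((Classical.choose (v.valuation_exists_uniformizer K) : K) : v.adicCompletion K) = _
  rw [HeightOneSpectrum.valuedAdicCompletion_eq_valuation']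
  exact Classical.choose_spec (v.valuation_exists_uniformizer K)

/-- In rank one the finite-adelic Hecke element `t_{v,i}` of `CompletedCohomologyHeckeAlgebraGLn`
is, inside `GL₁(𝔸_K)`, the Hecke element `heckeDiagAt` of the fixed uniformiser. [folklore] -/
theorem BigHeckeGLn.ofFinite_heckeElement_one (v : HeightOneSpectrum (𝓞 K)) (i : ℕ) :
    GLn.ofFinite 1 K (BigHeckeGLn.heckeElement 1 K v i) =
      heckeDiagAt 1 K v (BigHeckeGLn.uniformizerAt v) i := by
  refine Matrix.GeneralLinearGroup.ext fun a b => ?_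
  rw [Subsingleton.elim a 0, Subsingleton.elim b 0, GLn.coe_ofFinite_apply, Matrix.one_apply_eq,
    BigHeckeGLn.heckeElement, heckeDiagAt, coe_glDiagonal, coe_glDiagonal, Matrix.diagonal_apply_eq,
    Matrix.diagonal_apply_eq]
  split_ifs <;> rfl

/-- For two uniformisers `ϖ, ϖ'` of `K_v` and `v ∤ 𝔫 ≠ 0`, `t_{v,i}(ϖ)⁻¹ t_{v,i}(ϖ')` lies in the
principal congruence subgroup `K(𝔫)` (it is `ι_v(diag(u,…))`, `u = ϖ⁻¹ ϖ' ∈ 𝒪_vˣ`, and `K(𝔫)` is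
maximal at `v`; cf. `heckeOperatorAt_heckeDiagAt_eq_of_valuation_eq`). Cartier, Corvallis (1979),
§IV.1. [cite: CartierCorvallis1979, §IV.1] -/
theorem heckeDiagAt_inv_mul_heckeDiagAt_mem_principalCongruenceLevel {n : ℕ}
    {v : HeightOneSpectrum (𝓞 K)} {𝔫 : Ideal (𝓞 K)} (h𝔫 : 𝔫 ≠ 0) (hv : ¬ v.asIdeal ∣ 𝔫)
    {ϖ ϖ' : (v.adicCompletion K)ˣ}
    (h : Valued.v (ϖ : v.adicCompletion K) = Valued.v (ϖ' : v.adicCompletion K)) (i : ℕ) :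
    (heckeDiagAt n K v ϖ i)⁻¹ * heckeDiagAt n K v ϖ' i ∈ principalCongruenceLevel n K 𝔫 := by
  rw [heckeDiagAt_eq_ofLocal_glDiagonal, heckeDiagAt_eq_ofLocal_glDiagonal, ← map_inv, ← map_mul,
    ← map_inv, ← map_mul]
  refine isMaximalAt_principalCongruenceLevel n K v h𝔫 hv
    ⟨_, glDiagonal_mem_valuedCongruenceSubgroup_one (fun k => ?_) (fun k => ?_), rfl⟩
  · have hϖ0 : Valued.v (ϖ : v.adicCompletion K) ≠ 0 := by
      rw [ne_eq, map_eq_zero]; exact ϖ.ne_zero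
    simp only [Pi.mul_apply, Pi.inv_apply]
    split_ifs
    · rw [Units.val_mul, Units.val_inv_eq_inv_val, map_mul, map_inv₀, ← h, inv_mul_cancel₀ hϖ0]
    · simp
  · have hϖ0 : Valued.v (ϖ' : v.adicCompletion K) ≠ 0 := by
      rw [ne_eq, map_eq_zero]; exact ϖ'.ne_zero
    simp only [Pi.mul_apply, Pi.inv_apply]
    split_ifs
    · rw [mul_inv_rev, inv_inv, Units.val_mul, Units.val_inv_eq_inv_val, map_mul, map_inv₀, h,
        inv_mul_cancel₀ hϖ0]
    · simp

/-- **The quasi-character at the Hecke elements is the Satake eigenvalue.** Let `π = W / W'` be an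
automorphic representation of `GL₁(𝔸_K)` with quasi-character `ω` (`r(g) φ - ω(g) φ ∈ W'`),
trivial on the principal congruence subgroup `K(𝔫)` (`𝔫 ≠ 0`), and let `α` be a Satake parameter
of `π` at `v ∤ 𝔫` (`HasSatakeParamAt`: Hecke eigenvalues `q_v^{i(1-i)/2} e_i(α)` modulo `W'` of a
form of some level prime to `v`, for some uniformiser).  Then
`ω(t_{v,i}) = q_v^{i(1-i)/2} e_i(α)` for `i ≤ 1`, `t_{v,i}` the Hecke element of the fixed
uniformiser: in rank one `[U t U] = r(t)` (`heckeOperator_rightTranslation_glOne`), and changing the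
uniformiser changes `t_{v,i}` by an element of `K(𝔫)`. Tate (1950), §2.3; Borel–Jacquet 1979, 4.6.
[cite: BorelJacquet1979, 4.6] -/
theorem AutomorphicRepData.quasiCharacter_heckeElement_eq_of_hasSatakeParamAt
    (π : AutomorphicRepData (AutomorphyDatum.gl 1 K hcpt)) {ω : (AdelicGroupData.gl 1 K).Adelic →* ℂˣ}
    (hω : ∀ (g : (AdelicGroupData.gl 1 K).Adelic), ∀ φ ∈ π.W,
      rightTranslation (AdelicGroupData.gl 1 K) g φ - ((ω g : ℂˣ) : ℂ) • φ ∈ π.W')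
    {𝔫 : Ideal (𝓞 K)} (h𝔫 : 𝔫 ≠ 0)
    (hω𝔫 : ∀ u ∈ principalCongruenceLevel 1 K 𝔫, ω (show (AdelicGroupData.gl 1 K).Adelic from u) = 1)
    {v : HeightOneSpectrum (𝓞 K)} (hv : ¬ v.asIdeal ∣ 𝔫) {α : Multiset ℂ}
    (hα : π.HasSatakeParamAt v α) {i : ℕ} (hi : i ≤ 1) :
    ((ω (show (AdelicGroupData.gl 1 K).Adelic from GLn.ofFinite 1 K (BigHeckeGLn.heckeElement 1 K v i)) :
        ℂˣ) : ℂ) =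
      ((((Real.sqrt (v.residueCard : ℝ)) : ℝ) : ℂ) ^ (i * (1 - i)) * α.esymm i) := by
  obtain ⟨𝔪, ϖ, h𝔪, hv𝔪, hϖ, -, φv, hφvW, hφvW', hfix, heig⟩ := hα
  have hfix' : IsRightInvariantUnder (principalCongruenceLevel 1 K 𝔪) φv :=
    fun u hu g => congr_fun (hfix u hu) g
  -- `ω(t_{v,i}(ϖ))` is the Satake eigenvalue
  have hT := heig i hi
  rw [heckeOperator_rightTranslation_glOne _ _ hfix'] at hT
  have h1 : ((ω (show (AdelicGroupData.gl 1 K).Adelic from heckeDiagAt 1 K v ϖ i) : ℂˣ) : ℂ) =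
      ((((Real.sqrt (v.residueCard : ℝ)) : ℝ) : ℂ) ^ (i * (1 - i)) * α.esymm i) :=
    π.eq_of_sub_smul_mem (hω _) hφvW hφvW' hT
  -- change of uniformiser inside `K(𝔫)`
  have hval : Valued.v (ϖ : v.adicCompletion K) =
      Valued.v ((BigHeckeGLn.uniformizerAt v : (v.adicCompletion K)ˣ) : v.adicCompletion K) := by
    rw [hϖ, BigHeckeGLn.valued_uniformizerAt]
  have hmem := heckeDiagAt_inv_mul_heckeDiagAt_mem_principalCongruenceLevel (n := 1) h𝔫 hv hval i
  have h2 : (show (AdelicGroupData.gl 1 K).Adelic from GLn.ofFinite 1 K (BigHeckeGLn.heckeElement 1 K v i)) =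
      (show (AdelicGroupData.gl 1 K).Adelic from heckeDiagAt 1 K v ϖ i) *
        (show (AdelicGroupData.gl 1 K).Adelic from
          (heckeDiagAt 1 K v ϖ i)⁻¹ * heckeDiagAt 1 K v (BigHeckeGLn.uniformizerAt v) i) := by
    rw [BigHeckeGLn.ofFinite_heckeElement_one]
    exact (mul_inv_cancel_left _ _).symm
  rw [h2, map_mul, hω𝔫 _ hmem, mul_one, h1]

end Satake

end Literature.NumberTheory.Automorphic
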